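import Literature.Combinatorics.Sahi2008.FKG
import Literature.Probability.Percolation.DecisionTreeBK
import Mathlib.Tactic.Linarith
import Mathlib.Tactic.Ring
import Mathlib.Tactic.FinCases
import HarnessLib

/-!
# `NoHeavyLowerTail` (crux stmt-CriticalPhenomena-4575), master-family line P1 (gen 22):
# second-order Harris for sunflowers, V — the conjecture at the generality of Sahi's FKG POSETS (any finite distributive lattice,
# any log-supermodular probability weight): typed, `k = 2` proved (FKG), monotone in `k`

Support file (seat `prim-masterthm-p1`, gen 22; `--supports stmt-CriticalPhenomena-4575`).  Standard axioms, no `sorry`.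
Memo `run/shared/lean/prim/prim-masterthm/FROM-prim-masterthm-p1-g22-SUNFLOWER-ONE-PAYER.md` §8.

WHY.  The product-measure conjecture `SahiDeepCore.SunflowerOnePayer k p` of `…SahiSunflowerOnePayer` (gen 22; `k = 3` ⟺ S₃^max) passed an
exact census on all sunflower partitions of `2^n`, `n ≤ 5`.  The SAME statement also passed (0 failures) for 1 200 random log-supermodular
measures on all 2 333 three- and four-petal systems of `2^4`, random FKG measures on `2^5, 2^6`, and on the products of chains `[3]³`, `[3]×[2]³`,
`[4]×[2]²`, `[m]×[m']` (≈ 2.5·10⁷ tests) — exactly as Gladkov's first-order inequality `μ(K)μ(O) ≥ e₂` extends from product to FKG measures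
(Bull. LMS 2024, Thm 3.2).  This file states the conjecture in Sahi's own setting [cite: Sahi2008, Conj. 5 (p. 212) — the setting: FKG posets]:
* `IsSunflower U K` (all pairwise intersections of the up-sets `U_i ⊆ α` equal `K`), `petalDown U i = ⋂_{j≠i} (U_j)ᶜ`, `outside U = ⋂_j (U_j)ᶜ`;
* **`OnePayerFKG k μ`** (typed conjecture): for every FKG probability weight `μ` on a finite distributive lattice `α` and every `k`-sunflower of
  up-sets, `μ(O) ≤ μ(K) ⟹ Π_i μ(U_i) ≤ μ(K)^{k−1}` and `μ(K) ≤ μ(O) ⟹ Π_i μ(D_i) ≤ μ(O)^{k−1}`;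
* `onePayerFKG_two` — `k = 2` holds: both halves are the FKG inequality (for `1_U, 1_V` resp. on the order dual);
* `onePayerFKG_of_succ`, `onePayerFKG_of_le` — `OnePayerFKG (k+1) μ → OnePayerFKG k μ` for `k ≥ 2` (pad with `U_k := K`);
* `onePayerFKG_dichotomy`.
On planar lattices (`[m]×[m']`) the census finds BOTH payers always paying (0 payer-failures in 7·10⁵ tests) — recorded in the memo, not asserted here.
HONEST FRAMING: typed conjecture with its `k ≤ 2` case; every `k ≥ 3` (in particular S₃^max) remains OPEN. [this work]
-/

noncomputable section

open scoped Classical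

namespace Summit.CriticalPhenomena.PercolationContinuityZ3.Theorems

namespace SahiSunflowerFKG

open Finset
open Literature.Combinatorics.Sahi2008
open Literature.Probability.Percolation.DecisionTree (ind ind_of_mem ind_of_not_mem ind_nonneg)

variable {α : Type} [Fintype α] [DistribLattice α]

local notation3 (prettyPrint := false) "m⟦" μ ", " X "⟧" => ex μ (ind X)

omit [Fintype α] in
/-- The indicator of an up-set is monotone. [folklore] -/
theorem monotone_ind_of_isUpperSet {X : Set α} (hX : IsUpperSet X) : Monotone (ind X) := by
  intro x y hle
  by_cases hx : x ∈ X
  · rw [ind_of_mem hx, ind_of_mem (hX hle hx)]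
  · rw [ind_of_not_mem hx]; exact ind_nonneg X y

omit [Fintype α] in
/-- The indicator of a down-set is monotone for the reversed order. [folklore] -/
theorem monotone_ind_toDual_of_isLowerSet {X : Set α} (hX : IsLowerSet X) :
    Monotone (fun a : αᵒᵈ => ind X (OrderDual.ofDual a)) := by
  intro a b hab
  have hba : OrderDual.ofDual b ≤ OrderDual.ofDual a := hab
  by_cases hb : OrderDual.ofDual a ∈ X
  · simp only [ind_of_mem hb, ind_of_mem (hX hba hb), le_refl]
  · simp only [ind_of_not_mem hb]; exact ind_nonneg X _

omit [Fintype α] [DistribLattice α] in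
/-- `1_{U ∩ V} = 1_U · 1_V`. [folklore] -/
theorem ind_inter_mul (U V : Set α) : ind (U ∩ V) = ind U * ind V := by
  funext x
  simp only [Pi.mul_apply]
  by_cases hU : x ∈ U
  · by_cases hV : x ∈ V
    · rw [ind_of_mem (show x ∈ U ∩ V from ⟨hU, hV⟩), ind_of_mem hU, ind_of_mem hV]; norm_num
    · rw [ind_of_not_mem (show x ∉ U ∩ V from fun h => hV h.2), ind_of_not_mem hV]; norm_num
  · rw [ind_of_not_mem (show x ∉ U ∩ V from fun h => hU h.1), ind_of_not_mem hU]; norm_num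

/-- Masses are nonnegative under an FKG weight. [folklore] -/
theorem mass_nonneg {μ : α → ℝ} (hμ : IsFKGMeasure μ) (X : Set α) : 0 ≤ m⟦μ, X⟧ :=
  ex_nonneg hμ.nonneg fun x => ind_nonneg X x

/-- The FKG weight read on the order dual is again an FKG weight. [cite: LiebSahi2021, footnote 2 (order reversal)] -/
theorem isFKGMeasure_dual {μ : α → ℝ} (hμ : IsFKGMeasure μ) :
    IsFKGMeasure (fun a : αᵒᵈ => μ (OrderDual.ofDual a)) where
  nonneg a := hμ.nonneg _
  sum_eq_one := hμ.sum_eq_one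
  mul_le_mul a b := by
    show μ (OrderDual.ofDual a) * μ (OrderDual.ofDual b) ≤
      μ (OrderDual.ofDual a ⊔ OrderDual.ofDual b) * μ (OrderDual.ofDual a ⊓ OrderDual.ofDual b)
    rw [mul_comm (μ (OrderDual.ofDual a ⊔ OrderDual.ofDual b))]
    exact hμ.mul_le_mul _ _

/-- **FKG for two increasing events**: `μ(U)μ(V) ≤ μ(U ∩ V)`. [cite: FortuinKasteleynGinibre1971, Thm. (Prop. 1)] -/
theorem fkg_up {μ : α → ℝ} (hμ : IsFKGMeasure μ) {U V : Set α} (hU : IsUpperSet U) (hV : IsUpperSet V) :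
    m⟦μ, U⟧ * m⟦μ, V⟧ ≤ m⟦μ, U ∩ V⟧ := by
  have h := ex_mul_ex_le_ex_mul hμ (f := ind U) (g := ind V) (fun x => ind_nonneg U x) (fun x => ind_nonneg V x)
    (monotone_ind_of_isUpperSet hU) (monotone_ind_of_isUpperSet hV)
  rwa [← ind_inter_mul] at h

/-- **FKG for two decreasing events**: `μ(X)μ(Y) ≤ μ(X ∩ Y)` (the same inequality on the order dual). [cite: FortuinKasteleynGinibre1971, Thm. (Prop. 1)] -/
theorem fkg_down {μ : α → ℝ} (hμ : IsFKGMeasure μ) {X Y : Set α} (hX : IsLowerSet X) (hY : IsLowerSet Y) :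
    m⟦μ, X⟧ * m⟦μ, Y⟧ ≤ m⟦μ, X ∩ Y⟧ := by
  have h := ex_mul_ex_le_ex_mul (isFKGMeasure_dual hμ)
    (f := fun a => ind X (OrderDual.ofDual a)) (g := fun a => ind Y (OrderDual.ofDual a))
    (fun a => ind_nonneg X _) (fun a => ind_nonneg Y _)
    (monotone_ind_toDual_of_isLowerSet hX) (monotone_ind_toDual_of_isLowerSet hY)
  rw [ind_inter_mul]
  exact h

/-! ### Sunflowers and the typed conjecture -/

omit [Fintype α] [DistribLattice α] in
/-- `U_0, …, U_{k−1}` is a SUNFLOWER with kernel `K`: all pairwise intersections equal `K` (a predicate). [this work] -/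
def IsSunflower {k : ℕ} (U : Fin k → Set α) (K : Set α) : Prop :=
  ∀ i j, i ≠ j → U i ∩ U j = K

omit [Fintype α] [DistribLattice α] in
/-- The complementary down-set of member `i`: `D_i = ⋂_{j ≠ i} (U_j)ᶜ`. [this work] -/
def petalDown {k : ℕ} (U : Fin k → Set α) (i : Fin k) : Set α :=
  {x | ∀ j, j ≠ i → x ∉ U j}

omit [Fintype α] [DistribLattice α] in
/-- The outside `O = ⋂_j (U_j)ᶜ`. [this work] -/
def outside {k : ℕ} (U : Fin k → Set α) : Set α :=
  {x | ∀ j, x ∉ U j}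

/-- **CONJECTURE (second-order FKG for sunflowers; typed, Sahi's FKG-poset generality).**  For an FKG probability weight `μ` on a finite
distributive lattice and every `k`-sunflower of up-sets with kernel `K` and outside `O`: `μ(O) ≤ μ(K) ⟹ Π_i μ(U_i) ≤ μ(K)^{k−1}` and
`μ(K) ≤ μ(O) ⟹ Π_i μ(D_i) ≤ μ(O)^{k−1}`.  `k = 2` is FKG (`onePayerFKG_two`); monotone in `k` (`onePayerFKG_of_succ`); for product measures on
Boolean lattices it is `SahiDeepCore.SunflowerOnePayer` (`k = 3` ⟺ S₃^max).  Census in the file header. [this work] [status: open] -/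
@[conjecture] def OnePayerFKG (k : ℕ) (μ : α → ℝ) : Prop :=
  IsFKGMeasure μ → ∀ (U : Fin k → Set α) (K : Set α), (∀ i, IsUpperSet (U i)) → IsSunflower U K →
    (m⟦μ, outside U⟧ ≤ m⟦μ, K⟧ → ∏ i, m⟦μ, U i⟧ ≤ m⟦μ, K⟧ ^ (k - 1)) ∧
      (m⟦μ, K⟧ ≤ m⟦μ, outside U⟧ → ∏ i, m⟦μ, petalDown U i⟧ ≤ m⟦μ, outside U⟧ ^ (k - 1))

/-- The conjecture implies the plain dichotomy "kernel pays or outside pays". [this work] -/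
theorem onePayerFKG_dichotomy {k : ℕ} {μ : α → ℝ} (hμ : IsFKGMeasure μ) (h : OnePayerFKG k μ)
    (U : Fin k → Set α) (K : Set α) (hU : ∀ i, IsUpperSet (U i)) (hK : IsSunflower U K) :
    ∏ i, m⟦μ, U i⟧ ≤ m⟦μ, K⟧ ^ (k - 1) ∨ ∏ i, m⟦μ, petalDown U i⟧ ≤ m⟦μ, outside U⟧ ^ (k - 1) := by
  obtain ⟨hc, ho⟩ := h hμ U K hU hK
  rcases le_total (m⟦μ, outside U⟧) (m⟦μ, K⟧) with hle | hle
  · exact Or.inl (hc hle)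
  · exact Or.inr (ho hle)

omit [Fintype α] [DistribLattice α] in
/-- The complementary down-sets are down-sets. [this work] -/
theorem isLowerSet_petalDown [Preorder α] {k : ℕ} {U : Fin k → Set α} (hU : ∀ i, IsUpperSet (U i)) (i : Fin k) :
    IsLowerSet (petalDown U i) := by
  intro x y hle hx j hj hy
  exact hx j hj (hU j hle hy)

omit [Fintype α] [DistribLattice α] in
/-- Two distinct complementary down-sets meet exactly in the outside. [this work] -/
theorem petalDown_inter_petalDown {k : ℕ} (U : Fin k → Set α) {i j : Fin k} (hij : i ≠ j) :
    petalDown U i ∩ petalDown U j = outside U := by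
  ext x
  simp only [petalDown, outside, Set.mem_inter_iff, Set.mem_setOf_eq]
  constructor
  · rintro ⟨hi, hj⟩ l
    by_cases hl : l = i
    · subst hl; exact hj l hij
    · exact hi l hl
  · intro h
    exact ⟨fun l _ => h l, fun l _ => h l⟩

omit [Fintype α] [DistribLattice α] in
/-- In a sunflower with at least two members the kernel lies in every member. [this work] -/
theorem kernel_subset_of_isSunflower {k : ℕ} {U : Fin k → Set α} {K : Set α} (hK : IsSunflower U K)
    {i j : Fin k} (hij : i ≠ j) : K ⊆ U i := by
  rw [← hK i j hij]
  exact Set.inter_subset_left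

/-! ### `k = 2` is FKG -/

/-- **`k = 2` of the conjecture holds** on every FKG poset (both halves = FKG for increasing resp. decreasing indicators). [this work] -/
theorem onePayerFKG_two (μ : α → ℝ) : OnePayerFKG 2 μ := by
  intro hμ U K hU hK
  have h01 : U 0 ∩ U 1 = K := hK 0 1 (by decide)
  refine ⟨fun _ => ?_, fun _ => ?_⟩
  · rw [Fin.prod_univ_two, show (2 - 1 : ℕ) = 1 from rfl, pow_one, ← h01]
    exact fkg_up hμ (hU 0) (hU 1)
  · rw [Fin.prod_univ_two, show (2 - 1 : ℕ) = 1 from rfl, pow_one,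
      ← petalDown_inter_petalDown U (show (0 : Fin 2) ≠ 1 by decide)]
    exact fkg_down hμ (isLowerSet_petalDown hU 0) (isLowerSet_petalDown hU 1)

/-! ### Monotonicity in `k` -/

/-- **`OnePayerFKG (k+1) μ → OnePayerFKG k μ`** for `k ≥ 2` (pad a `k`-sunflower with the petal-free member `U_k := K`). [this work] -/
theorem onePayerFKG_of_succ (μ : α → ℝ) {k : ℕ} (hk : 2 ≤ k) (h : OnePayerFKG (k + 1) μ) : OnePayerFKG k μ := by
  intro hμ U K hU hK
  set i0 : Fin k := ⟨0, by omega⟩ with hi0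
  set i1 : Fin k := ⟨1, by omega⟩ with hi1
  have h01 : i0 ≠ i1 := by
    intro h'; have := congrArg Fin.val h'; simp [hi0, hi1] at this
  have hKsub : ∀ i, K ⊆ U i := by
    intro i
    by_cases hi : i = i0
    · subst hi; exact kernel_subset_of_isSunflower hK h01
    · exact kernel_subset_of_isSunflower hK hi
  have hKup : IsUpperSet K := by rw [← hK i0 i1 h01]; exact (hU i0).inter (hU i1)
  set V : Fin (k + 1) → Set α := Fin.snoc U K with hV
  have hVc : ∀ i : Fin k, V (Fin.castSucc i) = U i := fun i => by simp [hV]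
  have hVl : V (Fin.last k) = K := by simp [hV]
  have hVup : ∀ i, IsUpperSet (V i) := by
    intro i
    refine Fin.lastCases ?_ (fun j => ?_) i
    · rw [hVl]; exact hKup
    · rw [hVc]; exact hU j
  have hVK : IsSunflower V K := by
    intro i j hij
    induction i using Fin.lastCases with
    | last =>
      induction j using Fin.lastCases with
      | last => exact absurd rfl hij
      | cast j => rw [hVl, hVc]; exact Set.inter_eq_left.2 (hKsub j)
    | cast i =>
      induction j using Fin.lastCases with
      | last => rw [hVl, hVc]; exact Set.inter_eq_right.2 (hKsub i)
      | cast j =>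
        rw [hVc, hVc]
        exact hK i j fun h' => hij (by rw [h'])
  have hO : outside V = outside U := by
    ext x
    simp only [outside, Set.mem_setOf_eq, Fin.forall_fin_succ', hVc, hVl]
    constructor
    · exact fun h' => h'.1
    · exact fun h' => ⟨h', fun hx => h' i0 (hKsub i0 hx)⟩
  have hDc : ∀ i : Fin k, petalDown V (Fin.castSucc i) = petalDown U i := by
    intro i
    ext x
    simp only [petalDown, Set.mem_setOf_eq, Fin.forall_fin_succ', hVc, hVl]
    constructor
    · intro h' j hj
      exact h'.1 j fun h'' => hj (Fin.castSucc_injective _ h'')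
    · intro h'
      refine ⟨fun j hj => h' j fun h'' => hj (by rw [h'']), fun _ hx => ?_⟩
      by_cases hi : i = i0
      · exact h' i1 (fun h'' => h01 (h''.trans hi).symm) (hKsub i1 hx)
      · exact h' i0 (fun h'' => hi h''.symm) (hKsub i0 hx)
  have hDl : petalDown V (Fin.last k) = outside U := by
    ext x
    simp only [petalDown, outside, Set.mem_setOf_eq, Fin.forall_fin_succ', hVc, hVl]
    constructor
    · intro h' j
      exact h'.1 j (Fin.castSucc_lt_last j).ne
    · intro h'
      exact ⟨fun j _ => h' j, fun h'' => absurd rfl h''⟩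
  obtain ⟨hc, ho⟩ := h hμ V K hVup hVK
  have hkk : (k + 1 - 1 : ℕ) = k - 1 + 1 := by omega
  refine ⟨fun hle => ?_, fun hle => ?_⟩
  · have hc' := hc (by rwa [hO])
    rw [Fin.prod_univ_castSucc, hVl, hkk, pow_succ] at hc'
    simp only [hVc] at hc'
    by_cases hKpos : 0 < m⟦μ, K⟧
    · exact le_of_mul_le_mul_right hc' hKpos
    · have hK0 : m⟦μ, K⟧ = 0 := le_antisymm (not_lt.1 hKpos) (mass_nonneg hμ K)
      have hh := fkg_up hμ (hU i0) (hU i1)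
      rw [hK i0 i1 h01, hK0] at hh
      have hz : m⟦μ, U i0⟧ * m⟦μ, U i1⟧ = 0 :=
        le_antisymm hh (mul_nonneg (mass_nonneg hμ _) (mass_nonneg hμ _))
      have hprod : ∏ i, m⟦μ, U i⟧ = 0 := by
        rcases mul_eq_zero.1 hz with h0 | h1
        · exact Finset.prod_eq_zero (Finset.mem_univ i0) h0
        · exact Finset.prod_eq_zero (Finset.mem_univ i1) h1
      rw [hprod]
      exact pow_nonneg (mass_nonneg hμ K) _
  · have ho' := ho (by rwa [hO])
    rw [Fin.prod_univ_castSucc, hDl, hO, hkk, pow_succ] at ho'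
    simp only [hDc] at ho'
    by_cases hOpos : 0 < m⟦μ, outside U⟧
    · exact le_of_mul_le_mul_right ho' hOpos
    · have hO0 : m⟦μ, outside U⟧ = 0 := le_antisymm (not_lt.1 hOpos) (mass_nonneg hμ _)
      have hh := fkg_down hμ (isLowerSet_petalDown hU i0) (isLowerSet_petalDown hU i1)
      rw [petalDown_inter_petalDown U h01, hO0] at hh
      have hz : m⟦μ, petalDown U i0⟧ * m⟦μ, petalDown U i1⟧ = 0 :=
        le_antisymm hh (mul_nonneg (mass_nonneg hμ _) (mass_nonneg hμ _))
      have hprod : ∏ i, m⟦μ, petalDown U i⟧ = 0 := by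
        rcases mul_eq_zero.1 hz with h0 | h1
        · exact Finset.prod_eq_zero (Finset.mem_univ i0) h0
        · exact Finset.prod_eq_zero (Finset.mem_univ i1) h1
      rw [hprod]
      exact pow_nonneg (mass_nonneg hμ _) _

/-- Hence every level `k ≥ 2` of the conjecture contains FKG (`k = 2`). [this work] -/
theorem onePayerFKG_of_le (μ : α → ℝ) {k l : ℕ} (hk : 2 ≤ k) (hkl : k ≤ l) (h : OnePayerFKG l μ) :
    OnePayerFKG k μ := by
  induction l, hkl using Nat.le_induction with
  | base => exact h
  | succ l hkl ih => exact ih (onePayerFKG_of_succ μ (le_trans hk hkl) h)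

end SahiSunflowerFKG

end Summit.CriticalPhenomena.PercolationContinuityZ3.Theorems

end
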